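import Summits.AtomisticToContinuum.Crystallization.Theorems.ChargedEnergyGapResidualSF
import HarnessLib

/-!
# Charged energy gap — lens-3 g64, node «BarlowRef» (R3) — part 8 (independent): the CORED (half-ball) packing count

Imports only the tree (`…ResidualSF`).  ELEMENTARY·PROVED, folklore volume packing in a HALF-BALL — the certified-constant input «half-space ×0.55»
of the P-Z₅c′ numerator (memo g64 §1 (E2)/(E3), §3): the sources of the cored tube load `TubeShareBoundH` (part 6) near a member `c` lie OUTSIDE the
core ball `B̄(x₀, ϱ)` while `dist c x₀ ≤ ℓ < ϱ`; expanding `‖x − x₀‖² = ‖x − c‖² + 2⟪x − c, c − x₀⟫ + ‖c − x₀‖²` puts every source within `A` of `c`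
in the closed half-space `⟪x − c', c − x₀⟫ ≥ 0` through the shifted centre `c' = c − (δ/‖c − x₀‖)(c − x₀)` as soon as `A² + ℓ² ≤ ϱ² + 2δℓ`, and within
`A + δ` of `c'`.  An `s`-separated set in a half-ball of radius `A'` has at most `4((A' + s)/s)³` points (the `s/2`-balls about the points are
disjoint and lie in the half-ball of radius `A' + s` about a centre shifted by `s/2` more; a half-ball has at most half the volume of its ball, by the
point reflection, with no appeal to the hyperplane being null).

* ★ `two_mul_volume_halfBall_le` : `2 · vol(B(c, ρ) ∩ {⟪x − c, v⟫ > 0}) ≤ vol B(c, ρ)`;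
* ★ `card_le_of_separated_halfBall` : `s`-separated `T ⊆ {dist · c ≤ A, ⟪· − c, v⟫ ≥ 0}` (`v ≠ 0`) ⟹ `#T ≤ 4((A + s)/s)³`;
* `inner_ge_of_cored_source` : `ϱ ≤ dist x x₀`, `dist x c ≤ A`, `A² + dist c x₀² ≤ ϱ² + 2δ·dist c x₀` ⟹ `−δ‖c − x₀‖ ≤ ⟪x − c, c − x₀⟫`;
* ★★ `card_le_of_separated_cored` : `s`-separated `T ⊆ B̄(c, A) ∖ B(x₀, ϱ)`, `c ≠ x₀`, `A² + dist c x₀² ≤ ϱ² + 2δ·dist c x₀` ⟹ `#T ≤ 4((A + δ + s)/s)³`;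
  `IsSeparatedRef.card_cored_le` (reference form);
* record arithmetic `record_cored_shift` (`A = 20`, `ϱ = 160`, `ℓ ≤ 159` ⟹ `δ = 13/50` works) and `record_cored_count` (`s = 21/25`: `4·((20 + 13/50 +
  21/25)/(21/25))³ < 63 420`, against the full-ball `((40 + 21/25)/(21/25))³ > 114 900`: the factor `0.552`).

0 sorry; standard axioms.
-/

noncomputable section

open scoped Classical RealInnerProductSpace

open MeasureTheory
open Literature.MathematicalPhysics.StatisticalMechanics Literature.Geometry.DiscreteGeometry
open Summit.AtomisticToContinuum.Crystallization.Theses.PricedLinkCensus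
open Summit.AtomisticToContinuum.Crystallization.Theorems.ChargedEnergyGapNegative

namespace Summit.AtomisticToContinuum.Crystallization.Theorems.ChargedEnergyGapChartDial

section CoredCount

/-- The open half-ball `B(c, ρ) ∩ {⟪x − c, v⟫ > 0}` is measurable. -/
theorem measurableSet_halfBall (c v : E3) (ρ : ℝ) : MeasurableSet (Metric.ball c ρ ∩ {x : E3 | 0 < ⟪x - c, v⟫}) :=
  measurableSet_ball.inter (measurableSet_lt measurable_const ((measurable_id.sub measurable_const).inner measurable_const))

/-- ★ A HALF-BALL HAS AT MOST HALF THE VOLUME: `2 · vol(B(c, ρ) ∩ {⟪x − c, v⟫ > 0}) ≤ vol B(c, ρ)` (point reflection through `c`). -/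
theorem two_mul_volume_halfBall_le (c v : E3) (ρ : ℝ) :
    2 * volume (Metric.ball c ρ ∩ {x : E3 | 0 < ⟪x - c, v⟫}) ≤ volume (Metric.ball c ρ) := by
  set Hp : Set E3 := Metric.ball c ρ ∩ {x : E3 | 0 < ⟪x - c, v⟫} with hHp
  set Hm : Set E3 := Metric.ball c ρ ∩ {x : E3 | ⟪x - c, v⟫ < 0} with hHm
  have hf : MeasurePreserving (fun t : E3 => (c + c) - t) volume volume := Measure.measurePreserving_sub_left volume (c + c)
  have hpre : (fun t : E3 => (c + c) - t) ⁻¹' Hm = Hp := by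
    ext t
    simp only [hHp, hHm, Set.mem_preimage, Set.mem_inter_iff, Metric.mem_ball, Set.mem_setOf_eq]
    have h0 : c + c - t - c = -(t - c) := by abel
    have h1 : dist (c + c - t) c = dist t c := by rw [dist_eq_norm, dist_eq_norm, h0, norm_neg]
    have h2 : ⟪c + c - t - c, v⟫ = -⟪t - c, v⟫ := by rw [h0, inner_neg_left]
    rw [h1, h2, neg_lt_zero]
  have hmeasM : MeasurableSet Hm :=
    measurableSet_ball.inter (measurableSet_lt ((measurable_id.sub measurable_const).inner measurable_const) measurable_const)
  have hvol : volume Hp = volume Hm := by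
    rw [← hpre]; exact hf.measure_preimage hmeasM.nullMeasurableSet
  have hdisj : Disjoint Hp Hm := by
    rw [Set.disjoint_left]
    intro t ht ht'
    exact lt_asymm (show 0 < ⟪t - c, v⟫ from ht.2) (show ⟪t - c, v⟫ < 0 from ht'.2)
  have hsub : Hp ∪ Hm ⊆ Metric.ball c ρ := Set.union_subset Set.inter_subset_left Set.inter_subset_left
  calc 2 * volume Hp = volume Hp + volume Hm := by rw [two_mul, hvol]
    _ = volume (Hp ∪ Hm) := (measure_union hdisj hmeasM).symm
    _ ≤ volume (Metric.ball c ρ) := measure_mono hsub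

/-- ★ **HALF-BALL PACKING COUNT**: a finite `s`-separated set of points within `A` of `c` and in the closed half-space `⟪x − c, v⟫ ≥ 0` (`v ≠ 0`)
has at most `4((A + s)/s)³` points. -/
theorem card_le_of_separated_halfBall (T : Finset E3) {s A : ℝ} (hs : 0 < s) (hA : 0 ≤ A) (c v : E3) (hv : v ≠ 0)
    (hsep : ∀ p ∈ T, ∀ q ∈ T, p ≠ q → s ≤ dist p q) (hT : ∀ p ∈ T, dist p c ≤ A ∧ 0 ≤ ⟪p - c, v⟫) :
    (T.card : ℝ) ≤ 4 * ((A + s) / s) ^ 3 := by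
  have hvn : 0 < ‖v‖ := norm_pos_iff.2 hv
  have hs2 : (0 : ℝ) < s / 2 := by linarith
  set c' : E3 := c - (s / (2 * ‖v‖)) • v with hc'
  have hcc : dist c c' = s / 2 := by
    rw [dist_eq_norm, hc', sub_sub_cancel, norm_smul, Real.norm_eq_abs, abs_of_nonneg (by positivity)]
    field_simp
  have hinner_c : ⟪c - c', v⟫ = s / 2 * ‖v‖ := by
    rw [hc', sub_sub_cancel, real_inner_smul_left, real_inner_self_eq_norm_sq]
    field_simp
  -- the small balls are pairwise disjoint
  have hPD : (↑T : Set E3).PairwiseDisjoint fun p => Metric.ball p (s / 2) := by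
    intro p hp q hq hpq
    exact Metric.ball_disjoint_ball (by linarith [hsep p hp q hq hpq])
  -- and contained in the half-ball of radius A + s about c'
  have hcov : (⋃ p ∈ T, Metric.ball p (s / 2)) ⊆ Metric.ball c' (A + s) ∩ {x : E3 | 0 < ⟪x - c', v⟫} := by
    intro z hz
    rw [Set.mem_iUnion₂] at hz
    obtain ⟨p, hp, hz⟩ := hz
    rw [Metric.mem_ball] at hz
    obtain ⟨hpA, hpv⟩ := hT p hp
    refine ⟨?_, ?_⟩
    · rw [Metric.mem_ball]
      linarith [dist_triangle z p c, dist_triangle z c c']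
    · show 0 < ⟪z - c', v⟫
      have hsplit : z - c' = (z - p) + (p - c) + (c - c') := by abel
      rw [hsplit, inner_add_left, inner_add_left, hinner_c]
      have hzp : |⟪z - p, v⟫| ≤ ‖z - p‖ * ‖v‖ := abs_real_inner_le_norm _ _
      have hzp' : ‖z - p‖ < s / 2 := by rwa [← dist_eq_norm]
      have h3 : ‖z - p‖ * ‖v‖ < s / 2 * ‖v‖ := mul_lt_mul_of_pos_right hzp' hvn
      have h4 : -(s / 2 * ‖v‖) < ⟪z - p, v⟫ := by linarith [neg_abs_le ⟪z - p, v⟫]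
      linarith
  have hvolU : volume (⋃ p ∈ T, Metric.ball p (s / 2)) = ∑ p ∈ T, volume (Metric.ball p (s / 2)) :=
    measure_biUnion_finset hPD fun p _ => measurableSet_ball
  have hvol : 2 * ∑ p ∈ T, volume (Metric.ball p (s / 2)) ≤ volume (Metric.ball c' (A + s)) := by
    rw [← hvolU]
    calc 2 * volume (⋃ p ∈ T, Metric.ball p (s / 2)) ≤ 2 * volume (Metric.ball c' (A + s) ∩ {x : E3 | 0 < ⟪x - c', v⟫}) := by
          gcongr
      _ ≤ volume (Metric.ball c' (A + s)) := two_mul_volume_halfBall_le c' v (A + s)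
  simp only [EuclideanSpace.volume_ball_fin_three, Finset.sum_const, nsmul_eq_mul] at hvol
  rw [← ENNReal.ofReal_pow hs2.le, ← ENNReal.ofReal_pow (by linarith), ← ENNReal.ofReal_mul (by positivity),
    ← ENNReal.ofReal_mul (by positivity), ← ENNReal.ofReal_natCast, ← ENNReal.ofReal_mul (Nat.cast_nonneg _), ← ENNReal.ofReal_ofNat,
    ← ENNReal.ofReal_mul (by norm_num), ENNReal.ofReal_le_ofReal_iff (by positivity)] at hvol
  -- hvol : 2 * (card * ((s/2)^3 * (π*4/3))) ≤ (A+s)^3 * (π*4/3)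
  have hpi : 0 < Real.pi * 4 / 3 := by positivity
  have hkey : (T.card : ℝ) * (s / 2) ^ 3 * 2 ≤ (A + s) ^ 3 := by nlinarith
  have hs3 : (0 : ℝ) < s ^ 3 := by positivity
  have h8 : (T.card : ℝ) * s ^ 3 ≤ 4 * (A + s) ^ 3 := by nlinarith
  rw [div_pow, mul_div_assoc']
  exact (le_div_iff₀ hs3).2 h8

/-- The cored source inequality: a point outside the core ball `B(x₀, ϱ)` and within `A` of `c` satisfies `⟪x − c, c − x₀⟫ ≥ −δ‖c − x₀‖` whenever
`A² + ‖c − x₀‖² ≤ ϱ² + 2δ‖c − x₀‖`. -/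
theorem inner_ge_of_cored_source {x x₀ c : E3} {ϱ A δ : ℝ} (hϱ : 0 ≤ ϱ) (hx : ϱ ≤ dist x x₀) (hA : dist x c ≤ A)
    (hδ : A ^ 2 + dist c x₀ ^ 2 ≤ ϱ ^ 2 + 2 * δ * dist c x₀) : -(δ * ‖c - x₀‖) ≤ ⟪x - c, c - x₀⟫ := by
  have h1 : ‖x - x₀‖ ^ 2 = ‖x - c‖ ^ 2 + 2 * ⟪x - c, c - x₀⟫ + ‖c - x₀‖ ^ 2 := by
    rw [← norm_add_sq_real, sub_add_sub_cancel]
  rw [dist_eq_norm] at hx hA hδ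
  have h2 : ϱ ^ 2 ≤ ‖x - x₀‖ ^ 2 := pow_le_pow_left₀ hϱ hx 2
  have h3 : ‖x - c‖ ^ 2 ≤ A ^ 2 := pow_le_pow_left₀ (norm_nonneg _) hA 2
  nlinarith

/-- ★★ **THE CORED PACKING COUNT**: a finite `s`-separated set of points within `A` of `c` and outside the open core ball `B(x₀, ϱ)`, with `c ≠ x₀`
and a shift `δ ≥ 0` satisfying `A² + dist c x₀² ≤ ϱ² + 2δ·dist c x₀`, has at most `4((A + δ + s)/s)³` points. -/
theorem card_le_of_separated_cored (T : Finset E3) {s A δ ϱ : ℝ} (hs : 0 < s) (hA : 0 ≤ A) (hδ0 : 0 ≤ δ) (hϱ : 0 ≤ ϱ) (c x₀ : E3)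
    (hcx : c ≠ x₀) (hδ : A ^ 2 + dist c x₀ ^ 2 ≤ ϱ ^ 2 + 2 * δ * dist c x₀)
    (hsep : ∀ p ∈ T, ∀ q ∈ T, p ≠ q → s ≤ dist p q) (hT : ∀ p ∈ T, dist p c ≤ A ∧ ϱ ≤ dist p x₀) :
    (T.card : ℝ) ≤ 4 * ((A + δ + s) / s) ^ 3 := by
  set v : E3 := c - x₀ with hv
  have hv0 : v ≠ 0 := sub_ne_zero.2 hcx
  have hvn : 0 < ‖v‖ := norm_pos_iff.2 hv0
  set c' : E3 := c - (δ / ‖v‖) • v with hc'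
  have hcc : dist c c' = δ := by
    rw [dist_eq_norm, hc', sub_sub_cancel, norm_smul, Real.norm_eq_abs, abs_of_nonneg (by positivity)]
    field_simp
  have hinner_c : ⟪c - c', v⟫ = δ * ‖v‖ := by
    rw [hc', sub_sub_cancel, real_inner_smul_left, real_inner_self_eq_norm_sq]
    field_simp
  refine card_le_of_separated_halfBall T hs (by positivity) c' v hv0 hsep fun p hp => ?_
  obtain ⟨hpA, hpϱ⟩ := hT p hp
  refine ⟨by linarith [dist_triangle p c c'], ?_⟩
  have h1 : -(δ * ‖c - x₀‖) ≤ ⟪p - c, c - x₀⟫ := inner_ge_of_cored_source hϱ hpϱ hpA hδ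
  have hsplit : p - c' = (p - c) + (c - c') := by abel
  rw [hsplit, inner_add_left, hinner_c]
  rw [← hv] at h1
  linarith

variable {s : ℝ} {P : PeriodicConfiguration 3}

/-- Reference form: the sites of an `s`-separated reference within `A` of a member `c ≠ x₀` and outside the core ball `B(x₀, ϱ)` number at most
`4((A + δ + s)/s)³` (same shift condition). -/
theorem IsSeparatedRef.card_cored_le (hP : IsSeparatedRef s P) (hs : 0 < s) {A δ ϱ : ℝ} (hA : 0 ≤ A) (hδ0 : 0 ≤ δ) (hϱ : 0 ≤ ϱ) {c x₀ : E3}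
    (hcx : c ≠ x₀) (hδ : A ^ 2 + dist c x₀ ^ 2 ≤ ϱ ^ 2 + 2 * δ * dist c x₀) (T : Finset E3)
    (hT : ∀ p ∈ T, p ∈ P.points ∧ dist p c ≤ A ∧ ϱ ≤ dist p x₀) : (T.card : ℝ) ≤ 4 * ((A + δ + s) / s) ^ 3 :=
  card_le_of_separated_cored T hs hA hδ0 hϱ c x₀ hcx hδ (fun p hp q hq hpq => hP p (hT p hp).1 q (hT q hq).1 hpq)
    fun p hp => (hT p hp).2

/-- RECORD SHIFT (memo g64 §3): with `A = 20`, `ϱ = 160` and member level `dist c x₀ ≤ 159` the shift `δ = 13/50` satisfies the condition. -/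
theorem record_cored_shift {ℓ : ℝ} (h0 : 0 ≤ ℓ) (h1 : ℓ ≤ 159) : (20 : ℝ) ^ 2 + ℓ ^ 2 ≤ 160 ^ 2 + 2 * (13 / 50) * ℓ := by
  nlinarith

/-- RECORD COUNT at the sharp Barlow separation `s = 21/25`: the cored count `4((20 + 13/50 + 21/25)/(21/25))³ < 63 420` against the full-ball count
`((2·20 + 21/25)/(21/25))³ > 114 900` — the factor `0.552` («half-space ×0.55»). -/
theorem record_cored_count :
    4 * ((20 + 13 / 50 + 21 / 25) / (21 / 25) : ℝ) ^ 3 < 63420 ∧ (114900 : ℝ) < ((2 * 20 + 21 / 25) / (21 / 25)) ^ 3 := by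
  constructor <;> norm_num

end CoredCount

end Summit.AtomisticToContinuum.Crystallization.Theorems.ChargedEnergyGapChartDial

end
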